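import Literature.Geometry.Lorentzian.StationaryOrbitRiemannian
import Literature.Geometry.Lorentzian.StationaryOrbitDescent
import HarnessLib

/-!
# Anderson 2000, §0: the setting `(M, g_M) → (S, g_S, u)` of a chronological stationary spacetime,
# assembled

M. T. Anderson, *On stationary vacuum solutions to the Einstein equations*, Ann. Henri Poincaré 1
(2000), §0, (0.1)–(0.2): a chronological stationary space-time `(M, g_M)` with isometric
`ℝ`-action generated by the time-like Killing field `X` has a smooth, Hausdorff, paracompact
orbit space `S`, `π : M → S` a (principal `ℝ`-) bundle projection, and
`g_M = -u² (dt + θ)² + π^* g_S` with `g_S` the Riemannian metric induced on `S` by `g_M` on the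
horizontal spaces and `u² = -⟨X, X⟩ > 0` a function on `S`.

This file contains no new mathematics: it assembles, under **exactly the hypotheses of the named
fact `Anderson2000_completeStationaryVacuumFlat` that concern the group action** (a bundled
four-dimensional spacetime, a complete Killing field `X` timelike everywhere, chronology), the
formalisation of this setting spread over `StationaryOrbitSpace*.lean`,
`StationaryOrbitProjection.lean`, `StationaryOrbitHorizontal*.lean`,
`StationaryOrbitQuotientMetric*.lean`, `StationaryOrbitRiemannian.lean` and
`StationaryOrbitDescent.lean`, as one theorem `Anderson2000.orbitSpace_setting`:

1. `S = OrbitSpace X` with the slice charts is a `C^∞`, Hausdorff, second countable, connected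
   3-manifold;
2. `π = orbitProj X : M → S` is a surjective `C^∞` submersion whose fibres are the orbits of the
   stationary flow `θ = hX.flow`;
3. `g_S = hX.quotientMetric hchr` is a `C^∞` Riemannian metric on `S` with
   `π^* g_S = g + u⁻² X♭ ⊗ X♭` (Geroch's orbit form `h`, `PseudoRiemannianMetric.orbitBilin`);
4. the lapse `u = hX.lapse` is `C^∞` and positive on `S`, with `u ∘ π = (-⟨X, X⟩)^{1/2}`.

What is *not* formalised (and keeps the named fact a cited fact): the connection form `θ`/twist,
Lemma 1.1 (completeness of `(S, g_S)`), the reduced equations (1.3)–(1.6), and the analytic core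
of the paper (Cheeger–Gromov convergence/collapse, the Ernst-map Bochner argument).

## References

* M. T. Anderson, Ann. Henri Poincaré 1 (2000) 977–994, arXiv:gr-qc/0001091, §0, (0.1)–(0.2)
  (key `Anderson2000`).
-/

noncomputable section

open Bundle Set Filter Function Manifold TopologicalSpace
open scoped ContDiff Topology Manifold

namespace Literature.Geometry.Lorentzian

namespace Anderson2000

universe u

variable {𝓢 : Spacetime.{u} 4} [𝓢.metric.HasLeviCivita]
  {X : Π x : 𝓢.carrier, TangentSpace (𝓡 4) x}

/-- **Anderson 2000, §0, (0.1)–(0.2): the orbit-space setting of a chronological stationary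
spacetime, assembled.** For a four-dimensional spacetime `𝓢` with a complete Killing field `X`,
timelike and future-directed at every point (`IsStationaryKilling X univ`), satisfying the
chronology condition:
(1) the orbit space `S` (slice-chart structure) is a `C^∞`, Hausdorff, second countable, connected
3-manifold; (2) `π : M → S` is a surjective `C^∞` submersion and `π y = π y'` iff `y' = θ(t, y)`
for some `t` (the fibres are the orbits of the stationary flow); (3) the quotient metric `g_S` is a
`C^∞` Riemannian metric on `S` and `g_S(dπ v, dπ w) = h(v, w)`, `h = g − λ⁻¹ X♭ ⊗ X♭` (so
`g = -u²(dt + θ)² + π^* g_S` on horizontal/vertical vectors); (4) the lapse `u` is a positive `C^∞`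
function on `S` with `u(π y) = (-g_y(X, X))^{1/2}`. [cite: Anderson2000, §0, (0.1)–(0.2)] -/
theorem orbitSpace_setting (hX : 𝓢.IsStationaryKilling X univ)
    (hchr : 𝓢.metric.IsChronological 𝓢.timeOrientation) :
    letI := hX.orbitSpaceChartedSpace hchr
    haveI := (hX.isManifold_orbitSpace hchr).1
    -- (1) `S` is a smooth Hausdorff second countable connected 3-manifold
    (IsManifold (𝓡 3) ∞ (OrbitSpace X) ∧ T2Space (OrbitSpace X) ∧
      SecondCountableTopology (OrbitSpace X) ∧ ConnectedSpace (OrbitSpace X)) ∧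
    -- (2) `π` is a surjective `C^∞` submersion whose fibres are the orbits
    (ContMDiff (𝓡 4) (𝓡 3) ∞ (orbitProj X) ∧ Surjective (orbitProj X) ∧
      (∀ y, Surjective (mfderiv (𝓡 4) (𝓡 3) (orbitProj X) y)) ∧
      ∀ y y' : 𝓢.carrier, orbitProj X y = orbitProj X y' ↔ ∃ t : ℝ, hX.flow (t, y) = y') ∧
    -- (3) `g_S` is a `C^∞` Riemannian metric with `π^* g_S = h`
    ((hX.quotientMetric hchr).IsRiemannian ∧
      ∀ (y : 𝓢.carrier) (v w : TangentSpace (𝓡 4) y),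
        (hX.quotientMetric hchr).val (orbitProj X y) (mfderiv (𝓡 4) (𝓡 3) (orbitProj X) y v)
            (mfderiv (𝓡 4) (𝓡 3) (orbitProj X) y w) =
          𝓢.metric.toPseudoRiemannianMetric.orbitBilin X y v w) ∧
    -- (4) the lapse is a positive `C^∞` function on `S`, `u ∘ π = (-⟨X, X⟩)^{1/2}`
    (ContMDiff (𝓡 3) 𝓘(ℝ, ℝ) ∞ hX.lapse ∧ (∀ z, 0 < hX.lapse z) ∧
      ∀ y, hX.lapse (orbitProj X y) = Real.sqrt (-𝓢.metric.val y (X y) (X y))) := by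
  letI := hX.orbitSpaceChartedSpace hchr
  haveI := (hX.isManifold_orbitSpace hchr).1
  refine ⟨hX.isManifold_orbitSpace hchr, ⟨hX.contMDiff_orbitProj hchr, orbitProj_surjective X,
    hX.surjective_mfderiv_orbitProj hchr, fun y y' ↦ ?_⟩,
    ⟨hX.isRiemannian_quotientMetric hchr, hX.quotientMetric_val_mfderiv_orbitProj hchr⟩,
    ⟨hX.contMDiff_lapse hchr, hX.lapse_pos, hX.lapse_orbitProj⟩⟩
  -- fibres are orbits
  have hX1 := hX.contMDiff_one
  have hc : IsCompleteVectorField X := fun x ↦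
    ⟨fun t ↦ hX.flow (t, x), hX.isMIntegralCurve_flow x, hX.flow_zero x⟩
  rw [orbitProj_eq_iff X hX1 hc]
  exact mem_stationaryOrbit_singleton_iff_exists_flow_eq hX1 hX.isMIntegralCurve_flow hX.flow_zero

end Anderson2000

end Literature.Geometry.Lorentzian

end
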